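import Literature.AlgebraicTopology.Homotopy.SerreFibrationHardLefschetz
import Literature.AlgebraicTopology.Homotopy.SerreFibrationSequence
import Literature.AlgebraicTopology.Homotopy.SerreSkeletalCapDetection
import Literature.AlgebraicTopology.Homotopy.ExhaustedBundleCupGeneration
import HarnessLib

/-!
# `H⁴(E) = η ⌣ H²(E) + Σ_i ζ_i ⌣ H²(E)` for a surface bundle over a base exhausted by sublevels
# homotopy equivalent to finite `2`-complexes, from FIBREWISE hard Lefschetz and spanning

WIP header.
-/

noncomputable section

open Set Function CategoryTheory Topology
open Literature.AlgebraicTopology.SingularHomology Literature.Algebra.Homology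

namespace Literature.AlgebraicTopology.Homotopy

universe u v w

/-! ### A skeleton beyond the dimension is everything -/

section Skeleton

open RelCWComplex

variable {X : Type v} [TopologicalSpace X] [T2Space X] [CWComplex (univ : Set X)]

/-- For a complex without cells of dimension `≥ d`, the skeleton `skeletonLT d` is everything.
[folklore] -/
theorem skeletonLT_eq_univ_of_isEmpty_cell (d : ℕ)
    (hd : ∀ m, d ≤ m → IsEmpty (cell (univ : Set X) m)) :
    (skeletonLT (univ : Set X) d : Set X) = univ := by
  -- beyond `d` the skeleta are constant
  have hconst : ∀ m, d ≤ m → (skeletonLT (univ : Set X) m : Set X) = skeletonLT (univ : Set X) d := by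
    intro m hm
    induction m, hm using Nat.le_induction with
    | base => rfl
    | succ m hm ih =>
      haveI := hd m hm
      rw [Nat.cast_succ, ← skeletonLT_union_iUnion_closedCell_eq_skeletonLT_succ, iUnion_of_empty,
        union_empty, ih]
  refine eq_univ_of_forall fun x => ?_
  have hx : x ∈ ⋃ n : ℕ, (skeletonLT (univ : Set X) n : Set X) := by
    rw [CWComplex.iUnion_skeletonLT_eq_complex]; exact mem_univ x
  obtain ⟨m, hm⟩ := mem_iUnion.1 hx
  rcases le_total d m with h | h
  · rw [← hconst m h]; exact hm
  · exact skeletonLT_mono (by exact_mod_cast h) hm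

/-- Without cells of dimension `> 2`, `E₂ = p⁻¹(X²)` is all of `E`. [folklore] -/
theorem tot_two_eq_univ (hdim : ∀ m, 2 < m → IsEmpty (cell (univ : Set X) m))
    {E : Type u} (p : E → X) : CellsDirectSum.tot p 2 = univ := by
  change p ⁻¹' (skeletonLT (univ : Set X) ((2 : ℕ∞) + 1) : Set X) = univ
  rw [show ((2 : ℕ∞) + 1) = ((3 : ℕ) : ℕ∞) by norm_num,
    skeletonLT_eq_univ_of_isEmpty_cell 3 fun m hm => hdim m hm, preimage_univ]

end Skeleton

/-! ### Cap-detection of `H₄` of a Serre fibration over a finite `2`-complex from the fibres -/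

section SerreFibration

open RelCWComplex CellsDirectSum

variable (K : Type w) [Field K] {X : Type v} [TopologicalSpace X] [T2Space X]
  [CWComplex (univ : Set X)] {P : Type u} [TopologicalSpace P] {p : P → X}

/-- **Joint cap-detection of `H₄` of the total space from fibrewise hard Lefschetz and fibrewise
detection.** Let `p : P → X` be a Serre fibration over a Hausdorff CW complex without cells of
dimension `> 2`, `η ∈ H²(P; K)` with fibrewise hard Lefschetz for the cap product centred at
fibre degree `2` (`(η| ⌢ ·)ⁱ : H_{2+i}(p⁻¹x) ≅ H_{2-i}(p⁻¹x)`, `i ≤ 2` — compact Kähler surface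
fibres), and `ζ_i ∈ H²(P; K)` whose restrictions to every fibre jointly detect `H₂(p⁻¹x; K)` under
the cap product (e.g. they span `H²(p⁻¹x; K)`). Then a class `x ∈ H₄(P; K)` with `η ⌢ x = 0` and
`ζ_i ⌢ x = 0` for all `i` is zero: the skeletal filtration `E_s = p⁻¹(Xˢ)` has `E₂ = P`, its cap
endomorphism satisfies `EHardLefschetz 2` (`SerreHardLefschetz.eHardLefschetz_capEndo`), the
`ζ_i` detect `E¹_{2,4}` (`CellsDirectSum.Serre.relCapProduct_eq_zero_detect`), and the three-stage
descent applies (`Filtration.eq_zero_of_capProduct_eq_zero_of_eHardLefschetz_of_eq_univ`).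
[cite: Arapura2022, proof of Cor. 1.5 (p. 5) and proof of Thm. 1.2 (first reflection)]
[cite: VoisinHodgeII2003, Lemma 4.13 and Thm. 4.15 (proof)] [cite: Spanier1981, Ch. 9, Sec. 2, Lemma 2 and Thm. 15 (a)] -/
theorem eq_zero_of_capProduct_eq_zero_of_fibrewise (hp : IsSerreFibration p)
    (hdim : ∀ m, 2 < m → IsEmpty (cell (univ : Set X) m))
    (η : singularCohomology K K P 2) {ι : Type*} (ζ : ι → singularCohomology K K P 2)
    (hHL : ∀ (x : X) (lo i : ℕ), lo + i = 2 → i ≤ 2 →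
      Bijective (iterDown (V := fun k => singularHomology K K ↥(p ⁻¹' {x}) k)
        (fun k => capProduct (show 2 + k = k + 2 by omega)
          (singularCohomology.map K K (subsetIncl (p ⁻¹' {x})) 2 η)) i lo))
    (hdet : ∀ (x : X) (y : singularHomology K K ↥(p ⁻¹' {x}) 2),
      (∀ i, capProduct (show 2 + 0 = 0 + 2 by rfl)
        (singularCohomology.map K K (subsetIncl (p ⁻¹' {x})) 2 (ζ i)) y = 0) → y = 0)
    {x : singularHomology K K P 4}
    (hη : capProduct (show 2 + 2 = 4 by rfl) η x = 0)
    (hζ : ∀ i, capProduct (show 2 + 2 = 4 by rfl) (ζ i) x = 0) : x = 0 := by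
  classical
  have huniv : tot p 2 = univ := tot_two_eq_univ hdim p
  have hL := SerreHardLefschetz.eHardLefschetz_capEndo K hp η hHL
  -- detection of `E¹_{2,4} = H₄(E₂, E₁)` along the cells
  have hZ : ∀ e : relativeSingularHomology K K ↥(tot p 2) (Subtype.val ⁻¹' tot p 1) 4,
      (∀ i, relCapProduct (Subtype.val ⁻¹' tot p 1) (show 2 + 2 = 4 by rfl)
        (Filtration.restrictClass K (tot p) (ζ i) 2) e = 0) → e = 0 := by
    rw [← SerreHardLefschetz.low_succ_eq (p := p) 1]
    intro e he
    exact CellsDirectSum.Serre.relCapProduct_eq_zero_detect K hp ζ 0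
      (fun j y hy => hdet _ y hy) e he
  exact Filtration.eq_zero_of_capProduct_eq_zero_of_eHardLefschetz_of_eq_univ K (tot p)
    (SerreSkeleta.monotone_tot p) (SerreSkeleta.exists_subset_tot hp.continuous) η ζ huniv hL hZ
    hη hζ

end SerreFibration

/-! ### Transport of the fibre conditions along fibrewise homeomorphisms; the hypothesis `hP` -/

section Transport

variable (K : Type w) [Field K]

/-- Fibrewise hard Lefschetz in cap form is invariant under pull-back along a map inducing
bijections on homology (conjugation by `f_*`, projection formula). [folklore] -/
theorem bijective_iterDown_capProduct_map_iff {Y Y' : Type u} [TopologicalSpace Y]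
    [TopologicalSpace Y'] (f : C(Y', Y)) (hf : ∀ q, Bijective (singularHomology.map K K f q).hom)
    (κ : singularCohomology K K Y 2) (i lo : ℕ) :
    Bijective (iterDown (V := fun k => singularHomology K K Y' k)
        (fun k => capProduct (show 2 + k = k + 2 by omega)
          (singularCohomology.map K K f 2 κ)) i lo) ↔
      Bijective (iterDown (V := fun k => singularHomology K K Y k)
        (fun k => capProduct (show 2 + k = k + 2 by omega) κ) i lo) :=
  bijective_iterDown_iff_of_conj (V := fun k => singularHomology K K Y' k)
    (V' := fun k => singularHomology K K Y k) _ _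
    (fun k => (singularHomology.map K K f k).hom) hf
    (fun k x => capProduct_map f (show 2 + k = k + 2 by omega) κ x) i lo

variable {E B F : Type u} [TopologicalSpace E] [TopologicalSpace B] [TopologicalSpace F] {π : E → B}

/-- **The hypothesis `hP` of `exists_eq_cupProduct_add_sum_of_pullback_detect` from fibrewise
conditions on `π`.** If on every fibre `π⁻¹(b)` the class `η|` satisfies hard Lefschetz in cap
form centred at degree `2` and the `ζ_i|` jointly cap-detect `H₂`, then on every fibre bundle
`p : P → C` over a finite Hausdorff CW complex without cells of dimension `> 2` mapping
fibrewise into `π` with homeomorphisms of the fibres, the classes `φ^*η`, `φ^*ζ_i` jointly detect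
`H₄(P; K)` (transport the fibre conditions along the fibre homeomorphisms, then
`eq_zero_of_capProduct_eq_zero_of_fibrewise`). [cite: Arapura2022, proof of Cor. 1.5 (p. 5)]
[cite: HatcherAT2002, §3.3 p. 241] -/
theorem pullback_detect_of_fibrewise
    (η : singularCohomology K K E 2) {ι : Type} (ζ : ι → singularCohomology K K E 2)
    (hHL : ∀ (b : B) (lo i : ℕ), lo + i = 2 → i ≤ 2 →
      Bijective (iterDown (V := fun k => singularHomology K K ↥(π ⁻¹' {b}) k)
        (fun k => capProduct (show 2 + k = k + 2 by omega)
          (singularCohomology.map K K (subsetIncl (π ⁻¹' {b})) 2 η)) i lo))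
    (hdet : ∀ (b : B) (y : singularHomology K K ↥(π ⁻¹' {b}) 2),
      (∀ i, capProduct (show 2 + 0 = 0 + 2 by rfl)
        (singularCohomology.map K K (subsetIncl (π ⁻¹' {b})) 2 (ζ i)) y = 0) → y = 0) :
    ∀ (C : Type u) [TopologicalSpace C] [T2Space C] [CWComplex (univ : Set C)],
      RelCWComplex.Finite (univ : Set C) →
      (∀ m, 2 < m → IsEmpty (RelCWComplex.cell (univ : Set C) m)) →
      ∀ (P : Type u) [TopologicalSpace P] (p : P → C), IsFibreBundleWith F p →
      ∀ (g : C(C, B)) (φ : C(P, E)), (∀ x, π (φ x) = g (p x)) →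
      (∀ c, ∃ h : ↥(p ⁻¹' {c}) ≃ₜ ↥(π ⁻¹' {g c}), ∀ x, (h x : E) = φ x) →
      ∀ x : singularHomology K K P 4,
        capProduct (show 2 + 2 = 4 by rfl) (singularCohomology.map K K φ 2 η) x = 0 →
        (∀ i, capProduct (show 2 + 2 = 4 by rfl) (singularCohomology.map K K φ 2 (ζ i)) x = 0) →
        x = 0 := by
  intro C _ _ _ _ hdim P _ p hp g φ hφ hfib x hηx hζx
  refine eq_zero_of_capProduct_eq_zero_of_fibrewise K hp.isSerreFibration hdim
    (singularCohomology.map K K φ 2 η) (fun i => singularCohomology.map K K φ 2 (ζ i))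
    (fun c lo i hloi hi => ?_) (fun c y hy => ?_) hηx hζx
  · -- hard Lefschetz on `p⁻¹c` from `π⁻¹(g c)` along the fibre homeomorphism
    obtain ⟨h, hh⟩ := hfib c
    have hcomp : (subsetIncl (π ⁻¹' {g c})).comp (h : C(↥(p ⁻¹' {c}), ↥(π ⁻¹' {g c}))) =
        φ.comp (subsetIncl (p ⁻¹' {c})) := ContinuousMap.ext fun z => hh z
    have hclass : singularCohomology.map K K (subsetIncl (p ⁻¹' {c})) 2
        (singularCohomology.map K K φ 2 η) =
        singularCohomology.map K K (h : C(↥(p ⁻¹' {c}), ↥(π ⁻¹' {g c}))) 2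
          (singularCohomology.map K K (subsetIncl (π ⁻¹' {g c})) 2 η) := by
      rw [← ModuleCat.comp_apply, ← singularCohomology.map_comp, ← hcomp,
        singularCohomology.map_comp, ModuleCat.comp_apply]
    rw [hclass, bijective_iterDown_capProduct_map_iff K _ (fun q =>
      (singularHomology.mapIso K K h q).toLinearEquiv.bijective)]
    exact hHL (g c) lo i hloi hi
  · -- detection on `p⁻¹c` from `π⁻¹(g c)`
    obtain ⟨h, hh⟩ := hfib c
    have hcomp : (subsetIncl (π ⁻¹' {g c})).comp (h : C(↥(p ⁻¹' {c}), ↥(π ⁻¹' {g c}))) =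
        φ.comp (subsetIncl (p ⁻¹' {c})) := ContinuousMap.ext fun z => hh z
    have hclass : ∀ i, singularCohomology.map K K (subsetIncl (p ⁻¹' {c})) 2
        (singularCohomology.map K K φ 2 (ζ i)) =
        singularCohomology.map K K (h : C(↥(p ⁻¹' {c}), ↥(π ⁻¹' {g c}))) 2
          (singularCohomology.map K K (subsetIncl (π ⁻¹' {g c})) 2 (ζ i)) := fun i => by
      rw [← ModuleCat.comp_apply, ← singularCohomology.map_comp, ← hcomp,
        singularCohomology.map_comp, ModuleCat.comp_apply]
    have hbij : ∀ q, Bijective (singularHomology.map K K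
        (h : C(↥(p ⁻¹' {c}), ↥(π ⁻¹' {g c}))) q).hom := fun q =>
      (singularHomology.mapIso K K h q).toLinearEquiv.bijective
    -- `y ↦ h_* y` is injective, and `h_*` intertwines the cap products
    refine (hbij 2).1 ?_
    rw [map_zero]
    refine hdet (g c) _ fun i => ?_
    have := congrArg (singularHomology.map K K (h : C(↥(p ⁻¹' {c}), ↥(π ⁻¹' {g c}))) 0) (hy i)
    rw [map_zero, hclass i, capProduct_map] at this
    exact this

end Transport

/-! ### The generation theorem from fibrewise hypotheses -/

section Main

variable (K : Type w) [Field K] {E B F : Type u} [TopologicalSpace E] [TopologicalSpace B]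
  [TopologicalSpace F] {π : E → B}

/-- **`H⁴(E; K) = η ⌣ H²(E; K) + Σ_i ζ_i ⌣ H²(E; K)` from fibrewise hard Lefschetz and fibrewise
spanning** — the topological generation statement behind D. Arapura, *Hodge cycles and the Leray
filtration* (2022), proof of Cor. 1.5 ("`H²(U, R²f_*ℚ) ≅ ⊕_i H²(U, ℚ) ∪ [𝒵_i]`", with
`∪h : R¹ ≅ R³`, `R⁴ = ℚh²`, on the degenerate Leray spectral sequence), in Leray-free form. Let
`π : E → B` be a fibre bundle with fibre `F` of finite-dimensional bounded `K`-homology,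
`f : B → ℝ` continuous with cofinal levels `a` such that `{f ≤ a}` is homotopy equivalent to a
finite Hausdorff CW complex without cells of dimension `> 2` (Andreotti–Frankel for a smooth
affine surface, `AndreottiFrankelHomotopyType.lean`), `η ∈ H²(E; K)` with hard Lefschetz in cap
form on every fibre (`(η| ⌢ ·)ⁱ : H_{2+i}(π⁻¹b) ≅ H_{2-i}(π⁻¹b)`, `i ≤ 2`), and finitely many
`ζ_i ∈ H²(E; K)` whose restrictions to every fibre jointly cap-detect `H₂(π⁻¹b; K)` (e.g. span
`H²(π⁻¹b; K)`, `eq_zero_of_forall_capProduct_eq_zero_of_span`). Then every `c ∈ H⁴(E; K)` is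
`η ⌣ w + Σ_i ζ_i ⌣ u_i`. Proof: `exists_eq_cupProduct_add_sum_of_pullback_detect` with its
hypothesis `hP` supplied by `pullback_detect_of_fibrewise`.
[cite: Arapura2022, proof of Cor. 1.5 (p. 5) and proof of Thm. 1.2 (first reflection)]
[cite: VoisinHodgeII2003, Lemma 4.13 and Thm. 4.15 (proof)]
[cite: Spanier1981, Ch. 9, Sec. 2, Lemma 2 and Thm. 15 (a); Sec. 3, Thm. 1]
[cite: HatcherAT2002, §3.F Thm. 3F.8, §3.1 Thm. 3.2, §3.3 p. 241] -/
theorem exists_eq_cupProduct_add_sum_of_fibrewise (hπ : IsFibreBundleWith F π) {N : ℕ}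
    (hF : FinRelHomology K K F ∅ N) {f : B → ℝ} (hf : Continuous f)
    (hCW : ∀ b : ℝ, ∃ a : ℝ, b < a ∧ ∃ (C : Type u) (_ : TopologicalSpace C) (_ : T2Space C)
        (_ : CWComplex (univ : Set C)), RelCWComplex.Finite (univ : Set C) ∧
        (∀ m, 2 < m → IsEmpty (RelCWComplex.cell (univ : Set C) m)) ∧
        Nonempty (ContinuousMap.HomotopyEquiv ↥(f ⁻¹' Iic a) C))
    (η : singularCohomology K K E 2) {ι : Type} [Fintype ι] (ζ : ι → singularCohomology K K E 2)
    (hHL : ∀ (b : B) (lo i : ℕ), lo + i = 2 → i ≤ 2 →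
      Bijective (iterDown (V := fun k => singularHomology K K ↥(π ⁻¹' {b}) k)
        (fun k => capProduct (show 2 + k = k + 2 by omega)
          (singularCohomology.map K K (subsetIncl (π ⁻¹' {b})) 2 η)) i lo))
    (hdet : ∀ (b : B) (y : singularHomology K K ↥(π ⁻¹' {b}) 2),
      (∀ i, capProduct (show 2 + 0 = 0 + 2 by rfl)
        (singularCohomology.map K K (subsetIncl (π ⁻¹' {b})) 2 (ζ i)) y = 0) → y = 0)
    (c : singularCohomology K K E 4) :
    ∃ (w : singularCohomology K K E 2) (u : ι → singularCohomology K K E 2),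
      c = cupProduct (show 2 + 2 = 4 by rfl) η w +
        ∑ i, cupProduct (show 2 + 2 = 4 by rfl) (ζ i) (u i) :=
  exists_eq_cupProduct_add_sum_of_pullback_detect K hπ hF hf hCW η ζ
    (pullback_detect_of_fibrewise K η ζ hHL hdet) c

end Main

end Literature.AlgebraicTopology.Homotopy

end
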